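import Summits.CriticalPhenomena.PercolationContinuityZ3.Theorems.Transplant.Slab111VPlan
import HarnessLib

/-!
# The routing certificate for `ShapedLinkage 3 (Slab111.hexShadow k)`, III: soundness of the checker — the RIGID skeleton

builds on p205010 (kernel theorem, internal audit signed; external expert review pending) — NOT used in this file.  Lane `prim-bschramm`, seat
`prim-bschramm-p2` (gen 35; class C1b; memo `HOME/bschramm/P2-LATTICES.md` §129); helper file (`--supports stmt-CriticalPhenomena-4575 --as helper`).
First part of the soundness of `PlanD.check` («Slab111VPlan»): reading the Boolean checker back into propositions, and the film vertices, film paths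
and cleared-set membership of the RIGID pieces of a plan (`A, B, T1, T2`, the diamond) placed at a reference level `ℓ ≡ cls z (mod 3)`.
* §1 Boolean dictionary: `chainB_isChain`, `mstepB_iff`, `vOK_iff`, `hasCode_iff`, `codeFree_iff`, `colW_inBlk`, `lamMin_le`, `le_lamMax`;
* §2 film facts of relative vertices: `adj_absV` (an `MStep` is a film edge), `mem_W_absV` (cleared-set membership from the column test and the
  boundary codes), `mem_WR_absV`, `gpath_absV_of_chainB`;
* §3 regions: `blocks_of_eq_absV` (a film vertex over a footprint column at an envelope level IS blocked), `ne_absV_of_not_blocks`.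
[cite: DuminilCopinSidoraviciusTassion2016, §2.3 (proof of Fact 2: the three disjoint paths in B_R(z))]
-/

noncomputable section

namespace Summit.CriticalPhenomena.PercolationContinuityZ3.Theorems.Transplant

open Literature.Probability.Percolation Literature.Probability.LatticeModels SimpleGraph
open scoped Classical

namespace Slab111

variable {k : ℕ}

/-! ## §1 Boolean dictionary -/

/-- `mstepB` is `MStep`. [folklore] -/
theorem mstepB_iff {p q : MV} : mstepB p q = true ↔ MStep p q := by simp [mstepB]

/-- `vOK` is `RAdm`. [folklore] -/
theorem vOK_iff {p : MV} : vOK p = true ↔ RAdm p := by simp [vOK]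

/-- `isUpB` is `IsUp`. [folklore] -/
theorem isUpB_iff {p q : Col} : isUpB p q = true ↔ IsUp p q := by simp [isUpB]

/-- `chainB` is `List.IsChain MStep`. [folklore] -/
theorem chainB_isChain : ∀ {l : List MV}, chainB l = true → l.IsChain MStep
  | [], _ => List.IsChain.nil
  | [_], _ => List.IsChain.singleton _
  | a :: b :: l, h => by
    simp only [chainB, Bool.and_eq_true] at h
    exact List.IsChain.cons_cons (mstepB_iff.1 h.1) (chainB_isChain h.2)

/-- In the context of a block, `hasCode` reads the peel table. [folklore] -/
theorem hasCode_iff {K : BKey} {c0 kr : ℕ} {q : Col} {c : ℕ} :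
    (Ctx.of K c0 kr).hasCode q c = true ↔ c ∈ codesAt K.tR K.tD K.sR K.sD c0 kr q := by
  rw [mem_codesAt]
  simp only [Ctx.hasCode, Ctx.of, List.any_eq_true, Bool.and_eq_true, beq_iff_eq]
  constructor
  · rintro ⟨e, he, h1, h2⟩
    have : e = (q, c) := Prod.ext h1 h2
    rw [← this]; exact he
  · intro h; exact ⟨(q, c), h, rfl, rfl⟩

/-- `codeFree` excludes a code. [folklore] -/
theorem not_mem_of_codeFree {K : BKey} {c0 kr : ℕ} {q : Col} {c : ℕ} (h : codeFree (Ctx.of K c0 kr) c q = true) :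
    c ∉ codesAt K.tR K.tD K.sR K.sD c0 kr q := by
  intro hm
  have := hasCode_iff.2 hm
  simp [codeFree, this] at h

/-- Projections of `Ctx.of`. [folklore] -/
@[simp] theorem Ctx.of_K (K : BKey) (c0 kr : ℕ) : (Ctx.of K c0 kr).K = K := rfl
/-- Projections of `Ctx.of`. [folklore] -/
@[simp] theorem Ctx.of_c0 (K : BKey) (c0 kr : ℕ) : (Ctx.of K c0 kr).c0 = c0 := rfl
/-- Projections of `Ctx.of`. [folklore] -/
@[simp] theorem Ctx.of_kr (K : BKey) (c0 kr : ℕ) : (Ctx.of K c0 kr).kr = kr := rfl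

/-- A usable column lies in the cleared block (any context). [folklore] -/
theorem colW_inBlk {C : Ctx} {q : Col} (h : colW C q = true) : inBlkB C.K.tD C.K.sD q = true := by
  simp only [colW, Bool.and_eq_true] at h; exact h.1

/-- A rerouting column is usable and lies in the rerouting block (any context). [folklore] -/
theorem colRW_split {C : Ctx} {q : Col} (h : colRW C q = true) : inBlkB C.K.tR C.K.sR q = true ∧ colW C q = true := by
  simp only [colRW, Bool.and_eq_true] at h; exact ⟨h.1, h.2⟩

/-- A usable column lies in the cleared block and carries no code `4`. [folklore] -/
theorem colW_spec {K : BKey} {c0 kr : ℕ} {q : Col} (h : colW (Ctx.of K c0 kr) q = true) :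
    inBlkB K.tD K.sD q = true ∧ 4 ∉ codesAt K.tR K.tD K.sR K.sD c0 kr q := by
  simp only [colW, noCode4, Bool.and_eq_true, Bool.not_eq_true'] at h
  refine ⟨h.1, fun hm => ?_⟩
  have := hasCode_iff.2 hm
  exact absurd this (by simp [Ctx.of] at h ⊢; exact h.2)

/-- A rerouting column is usable and lies in the rerouting block. [folklore] -/
theorem colRW_spec {K : BKey} {c0 kr : ℕ} {q : Col} (h : colRW (Ctx.of K c0 kr) q = true) :
    inBlkB K.tR K.sR q = true ∧ colW (Ctx.of K c0 kr) q = true := by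
  simp only [colRW, Bool.and_eq_true] at h; exact ⟨h.1, h.2⟩

/-- `foldl min` is a lower bound of the start value. [folklore] -/
theorem foldl_min_le_init (a : ℤ) (l : List ℤ) : l.foldl min a ≤ a := by
  induction l generalizing a with
  | nil => simp
  | cons x xs ih => simp only [List.foldl_cons]; exact (ih _).trans (min_le_left _ _)

/-- `foldl min` is a lower bound of every element. [folklore] -/
theorem foldl_min_le_mem {a : ℤ} {l : List ℤ} {x : ℤ} (hx : x ∈ l) : l.foldl min a ≤ x := by
  induction l generalizing a with
  | nil => simp at hx
  | cons y ys ih =>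
    simp only [List.foldl_cons]
    rcases List.mem_cons.1 hx with rfl | hx
    · exact (foldl_min_le_init _ _).trans (min_le_right _ _)
    · exact ih hx

/-- `foldl max` is an upper bound of the start value. [folklore] -/
theorem le_foldl_max_init (a : ℤ) (l : List ℤ) : a ≤ l.foldl max a := by
  induction l generalizing a with
  | nil => simp
  | cons x xs ih => simp only [List.foldl_cons]; exact (le_max_left _ _).trans (ih _)

/-- `foldl max` is an upper bound of every element. [folklore] -/
theorem le_foldl_max_mem {a : ℤ} {l : List ℤ} {x : ℤ} (hx : x ∈ l) : x ≤ l.foldl max a := by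
  induction l generalizing a with
  | nil => simp at hx
  | cons y ys ih =>
    simp only [List.foldl_cons]
    rcases List.mem_cons.1 hx with rfl | hx
    · exact (le_max_right _ _).trans (le_foldl_max_init _ _)
    · exact ih hx

/-- Every rigid vertex has relative level `≥ λmin`. [folklore] -/
theorem lamMin_le {P : PlanD} {w : MV} (hw : w ∈ P.rigid) : P.lamMin ≤ w.2 :=
  foldl_min_le_mem (List.mem_map.2 ⟨w, hw, rfl⟩)

/-- Every rigid vertex has relative level `≤ λmax`. [folklore] -/
theorem le_lamMax {P : PlanD} {w : MV} (hw : w ∈ P.rigid) : w.2 ≤ P.lamMax :=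
  le_foldl_max_mem (List.mem_map.2 ⟨w, hw, rfl⟩)

/-- Membership in `P.rigid`. [folklore] -/
theorem mem_rigid_iff {P : PlanD} {w : MV} :
    w ∈ P.rigid ↔ w ∈ P.A ∨ w = P.y ∨ w = P.b ∨ w ∈ P.B ∨ w ∈ P.T1 ∨ w ∈ P.T2 := by
  simp only [PlanD.rigid, List.mem_append, List.mem_cons]; tauto

/-! ## §2 Film facts of relative vertices -/

/-- Absolute admissibility of a relative vertex in range. [folklore] -/
theorem madm_absV {z : Site 2} {ℓ : ℤ} (hℓ : ℓ % 3 = (cls z : ℤ)) {w : MV} (hv : vOK w = true) (h0 : 0 ≤ ℓ + w.2) (hk : ℓ + w.2 ≤ k) :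
    MAdm k (shiftMV z ℓ w) := madm_shift (dvd_of_emod_eq_cls hℓ) (vOK_iff.1 hv) h0 hk

/-- **An `MStep` between admissible relative vertices is a film edge.** [folklore] -/
theorem adj_absV {z : Site 2} {ℓ : ℤ} {p q : MV} (hp : MAdm k (shiftMV z ℓ p)) (hq : MAdm k (shiftMV z ℓ q)) (h : MStep p q) :
    (film k).Adj (absV k z ℓ p) (absV k z ℓ q) :=
  adj_toV_of_mstep hp hq ((mstep_shift_iff z ℓ p q).2 h)

/-- The shadow of `absV` is `vcol z` of the column. [folklore] -/
theorem sh_absV_vcol {z : Site 2} {ℓ : ℤ} {w : MV} (h : MAdm k (shiftMV z ℓ w)) : sh (absV k z ℓ w) = vcol z w.1 := by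
  rw [sh_absV h]; rfl

/-- **Cleared-set membership of a relative vertex** from the column test and the boundary code conditions of its level. [folklore] -/
theorem mem_W_absV {z : Site 2} {ℓ : ℤ} {K : BKey} (hℓ : ℓ % 3 = (cls z : ℤ)) {w : MV} (hv : vOK w = true)
    (hcol : colW (Ctx.of K (cls z) (k % 3)) w.1 = true) (h0 : 0 ≤ ℓ + w.2) (hk : ℓ + w.2 ≤ k)
    (hb0 : ℓ + w.2 = 0 → codeFree (Ctx.of K (cls z) (k % 3)) 0 w.1 = true) (hb1 : ℓ + w.2 = 1 → codeFree (Ctx.of K (cls z) (k % 3)) 1 w.1 = true)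
    (ht1 : ℓ + w.2 = (k : ℤ) - 1 → codeFree (Ctx.of K (cls z) (k % 3)) 2 w.1 = true)
    (ht0 : ℓ + w.2 = k → codeFree (Ctx.of K (cls z) (k % 3)) 3 w.1 = true) :
    absV k z ℓ w ∈ Wset k z K.tR K.tD K.sR K.sD := by
  have hadm := madm_absV hℓ hv h0 hk
  have hs : sh (absV k z ℓ w) = z + ![w.1.1, w.1.2] := sh_absV hadm
  have hlev : lev ((absV k z ℓ w : slab111 k) : Site 3) = ℓ + w.2 := lev_absV hadm
  obtain ⟨hblk, h4⟩ := colW_spec hcol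
  refine ⟨by rw [hs]; exact mem_blk_of_inBlkB hblk, not_peeled_of_forall hs fun c hc hm => ?_⟩
  rw [hlev] at hm
  unfold codeMatches at hm
  rcases hm with rfl | ⟨rfl, hL⟩ | ⟨rfl, hL⟩ | ⟨rfl, hL⟩ | ⟨rfl, hL⟩
  · exact h4 hc
  · exact not_mem_of_codeFree (hb0 hL) hc
  · exact not_mem_of_codeFree (hb1 hL) hc
  · exact not_mem_of_codeFree (ht1 hL) hc
  · exact not_mem_of_codeFree (ht0 hL) hc

/-- A middle-level relative vertex over a usable column is cleared. [folklore] -/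
theorem mem_W_absV_mid {z : Site 2} {ℓ : ℤ} {K : BKey} (hℓ : ℓ % 3 = (cls z : ℤ)) {w : MV} (hv : vOK w = true)
    (hcol : colW (Ctx.of K (cls z) (k % 3)) w.1 = true) (h2 : 2 ≤ ℓ + w.2) (hk : ℓ + w.2 ≤ (k : ℤ) - 2) :
    absV k z ℓ w ∈ Wset k z K.tR K.tD K.sR K.sD :=
  mem_W_absV hℓ hv hcol (by omega) (by omega) (fun h => by omega) (fun h => by omega) (fun h => by omega) (fun h => by omega)

/-- Membership in the rerouting part from membership in `W` and the rerouting column test. [folklore] -/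
theorem mem_WR_absV {z : Site 2} {ℓ : ℤ} {K : BKey} (hℓ : ℓ % 3 = (cls z : ℤ)) {w : MV} (hv : vOK w = true) (h0 : 0 ≤ ℓ + w.2) (hk : ℓ + w.2 ≤ k)
    (hW : absV k z ℓ w ∈ Wset k z K.tR K.tD K.sR K.sD) (hR : inBlkB K.tR K.sR w.1 = true) :
    absV k z ℓ w ∈ Wset k z K.tR K.tD K.sR K.sD ∩ (hexShadow k).lift (blkR 3 z K.tR K.sR) :=
  mem_WsetR_of (sh_absV (madm_absV hℓ hv h0 hk)) hW hR

/-- **A checked rigid chain is a film path** between the film vertices of its ends. [folklore] -/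
theorem gpath_absV_of_chainB {z : Site 2} {ℓ : ℤ} (hℓ : ℓ % 3 = (cls z : ℤ)) {l : List MV} (hne : l ≠ []) (hch : chainB l = true)
    (hnd : l.Nodup) (hv : ∀ w ∈ l, vOK w = true) (hrange : ∀ w ∈ l, 0 ≤ ℓ + w.2 ∧ ℓ + w.2 ≤ k) :
    GPath (film k) (l.map (absV k z ℓ)) (absV k z ℓ (l.head hne)) (absV k z ℓ (l.getLast hne)) :=
  gpath_of_relchain (dvd_of_emod_eq_cls hℓ) hne (fun p hp => vOK_iff.1 (hv p hp)) hrange (chainB_isChain hch) hnd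

/-- Injectivity of `absV` on valid vertices in range. [folklore] -/
theorem absV_injOn {z : Site 2} {ℓ : ℤ} (hℓ : ℓ % 3 = (cls z : ℤ)) {p q : MV} (hp : vOK p = true) (hp0 : 0 ≤ ℓ + p.2) (hpk : ℓ + p.2 ≤ k)
    (hq : vOK q = true) (hq0 : 0 ≤ ℓ + q.2) (hqk : ℓ + q.2 ≤ k) (h : absV k z ℓ p = absV k z ℓ q) : p = q :=
  absV_inj (madm_absV hℓ hp hp0 hpk) (madm_absV hℓ hq hq0 hqk) h

/-! ## §3 Regions -/

/-- The shadow and level of a film vertex determine whether a terminal option's region contains it: if a film vertex lies over a footprint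
column at a level of the envelope, the corresponding relative vertex is blocked. [folklore] -/
theorem blocks_of_sh_lev {z : Site 2} {ℓ : ℤ} {a : AttD} {e : Env} {q : Col} {v : slab111 k} (hq : q ∈ a.foot) (hs : sh v = vcol z q)
    {w : MV} (hw : MAdm k (shiftMV z ℓ w)) (heq : absV k z ℓ w = v) (he : e.mem (lev (v : Site 3) - ℓ) = true) :
    (TermD.ride a e).blocks w = true := by
  have h1 : sh (absV k z ℓ w) = vcol z w.1 := sh_absV_vcol hw
  rw [heq, hs] at h1
  have hqw : w.1 = q := (vcol_injective z h1).symm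
  have h2 : lev ((absV k z ℓ w : slab111 k) : Site 3) = ℓ + w.2 := lev_absV hw
  rw [heq] at h2
  have hl : lev (v : Site 3) - ℓ = w.2 := by rw [h2]; ring
  rw [hl] at he
  simp only [TermD.blocks, Bool.and_eq_true]
  exact ⟨by rw [hqw]; simpa using hq, he⟩

/-- **A rigid vertex that is not blocked by a ride option differs from every film vertex of that option's region.** [folklore] -/
theorem ne_of_not_blocks {z : Site 2} {ℓ : ℤ} {a : AttD} {e : Env} {q : Col} {v : slab111 k} (hq : q ∈ a.foot) (hs : sh v = vcol z q)
    (he : e.mem (lev (v : Site 3) - ℓ) = true) {w : MV} (hw : MAdm k (shiftMV z ℓ w)) (hnb : (TermD.ride a e).blocks w = false) :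
    absV k z ℓ w ≠ v := fun heq => by
  have := blocks_of_sh_lev hq hs hw heq he
  rw [hnb] at this; exact Bool.false_ne_true this

/-- Two film vertices over different columns differ. [folklore] -/
theorem ne_of_sh_ne {u v : slab111 k} (h : sh u ≠ sh v) : u ≠ v := fun heq => h (by rw [heq])

/-- Film vertices over disjoint footprints differ. [folklore] -/
theorem ne_of_foot_disjoint {z : Site 2} {a a' : AttD} (hcl : (TermD.ride a Env.any).clash (TermD.ride a' Env.any) = false)
    {q q' : Col} (hq : q ∈ a.foot) (hq' : q' ∈ a'.foot) {u v : slab111 k} (hu : sh u = vcol z q) (hv : sh v = vcol z q') : u ≠ v := by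
  apply ne_of_sh_ne
  rw [hu, hv]
  intro h
  have hqq : q = q' := vcol_injective z h
  subst hqq
  have : (TermD.ride a Env.any).clash (TermD.ride a' Env.any) = true := by
    simp only [TermD.clash, List.any_eq_true]
    exact ⟨q, hq, by simpa using hq'⟩
  rw [this] at hcl
  exact Bool.noConfusion hcl

end Slab111

end Summit.CriticalPhenomena.PercolationContinuityZ3.Theorems.Transplant

end
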